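import Mathlib
import HarnessLib
import Summits.ResolutionOfSingularities.ResolutionOfSingularities.Theses.EquisingularLift

/-!
# Route-posited objects of `EquisingularLift` — the STRATA split of the crux `EquisingularLift` (stmt-15660)

Definitions only (D-0016 `<RouteSlug>Defs.lean`; proofs live in
`Theorems/EquisingularLiftEquisingularLiftSplit.lean` and the stub files of the line `strata-split`).

Crux-strategist seat `planner-cstrat-stmt-ResolutionOfSingularities-15660-r1-0` (2026-08-17) cut the crux
`Theses.EquisingularLift.EquisingularLift` (EL: liftable embedded resolution of hypersurfaces over `k̄` in characteristic `p`,
recursor-encoded chain of blow-ups in regular horizontal centres) along the STRATA seam into two typed children, with the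
assembly `LiftableIsolation → IsolatedPointDrop → EquisingularLift` PROVED (`Cruxes/EquisingularLift/StrategySplit.lean`,
landed by the line lead as `Theorems/EquisingularLiftEquisingularLiftSplit.lean`). This file carries the statements:

* `Split.LiftableIsolation` (child 1): EL's data over a COMPLETE characteristic-0 DVR with algebraically closed residue
  field, concluding only that the reduced iterated strict transform has FINITELY MANY non-regular points, at each of which
  the blown-up ambient has good reduction (`GoodAt`).
* `Split.IsolatedPointDrop` (child 2): from any such stage with `≥ 1` non-regular point, a further liftable chain strictly
  lowers the number of non-regular points, keeping finiteness and good reduction.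
* helper notions `Split.Chain` (the recursor-encoded chain, verbatim the fifth conjunct of EL), `Split.singSet`,
  `Split.GoodAt`, `Split.GoodSet` — each unfolds by `Iff.rfl` to text inlined in the children.

Both children are OPEN sub-statements of an open problem (EL implies resolution of every projective hypersurface over
`k̄`, see `Theses.EquisingularLift.closes`); they are NOT literature facts and carry no citation tag. Rationale for the
good-reduction clause (monodromy trap on coalesced conjugate centres): `Cruxes/EquisingularLift/STRATEGY-CENSUS.md` §N3.
-/

set_option linter.dupNamespace false -- mandated namespace `Summit.<Summit>.<Problem>` of this single-conjunct summit

open CategoryTheory AlgebraicGeometry TopologicalSpace Topology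
open Literature.AlgebraicGeometry.Resolution

namespace Summit.ResolutionOfSingularities.ResolutionOfSingularities.Theses.EquisingularLift

namespace Split

/-! ## The two pieces (statements verbatim as they are filed as route items) -/

/-- **Child 1 (crux, rank 2): LIFTABLE ISOLATION.** For every prime `p`, every algebraically closed `k` of
characteristic `p`, every `n` and every integral closed `H ⊆ ℙⁿ_k` with locally principal ideal: there are a
COMPLETE DVR `O` of characteristic `0` with ALGEBRAICALLY CLOSED residue field, a smooth proper `q : P → Spec O`, a
closed `Y ⊆ P` inside the special fibre with `V(Y) ≅ H`, and `(P', σ, S')` reached from `(P, 𝟙, Y)` by finitely many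
blow-ups in REGULAR centres lying over non-generic points of `Y` (`S'` the iterated strict transform — the induction
principle of `IsEmbeddedTransform`, verbatim as in `EquisingularLift`), such that the special fibre of `P' → Spec O`
is IRREDUCIBLE (all centres horizontal), the reduced closed subscheme on `closure S'` has only FINITELY MANY
non-regular points, and at each of them the ambient `P'` is regular with the uniformizer of `O` a regular parameter
(good reduction of the blown-up ambient there). A route-posited OPEN sub-statement (child 1 of the strategist's split of the
crux; not a published result). Informal sources of the programme: Ishii 2025 (Thm 1.1 / Cor 1.5), Cossart–Jannsen–Saito 2020,
Bennett 1970, Kollár 2007 §3.13. -/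
def LiftableIsolation : Prop :=
  ∀ p : ℕ, p.Prime → ∀ (k : Type) [Field k] [CharP k p] [IsAlgClosed k] (n : ℕ) (H : AlgebraicGeometry.Scheme.{0}) (ι : H ⟶ (Literature.AlgebraicGeometry.Motives.projectiveSpace n k).left), AlgebraicGeometry.IsClosedImmersion ι → AlgebraicGeometry.IsIntegral H → (∀ y : (Literature.AlgebraicGeometry.Motives.projectiveSpace n k).left, ∃ U : (Literature.AlgebraicGeometry.Motives.projectiveSpace n k).left.affineOpens, y ∈ (U : (Literature.AlgebraicGeometry.Motives.projectiveSpace n k).left.Opens) ∧ (ι.ker.ideal U).IsPrincipal) → ∃ (O : Type) (_ : CommRing O) (_ : IsDomain O) (_ : IsDiscreteValuationRing O) (_ : CharZero O) (_ : IsAdicComplete (IsLocalRing.maximalIdeal O) O) (_ : IsAlgClosed (IsLocalRing.ResidueField O)) (P P' : AlgebraicGeometry.Scheme.{0}) (q : P ⟶ AlgebraicGeometry.Spec (.of O)) (Y : TopologicalSpace.Closeds P) (σ : P' ⟶ P) (S' : Set P'), AlgebraicGeometry.Smooth q ∧ AlgebraicGeometry.IsProper q ∧ (Y : Set P) ⊆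 q ⁻¹' {IsLocalRing.closedPoint O} ∧ Nonempty ((AlgebraicGeometry.Scheme.IdealSheafData.vanishingIdeal Y).subscheme ≅ H) ∧ (∀ Q : (∀ X' : AlgebraicGeometry.Scheme.{0}, (X' ⟶ P) → Set X' → Prop), Q P (CategoryTheory.CategoryStruct.id P) (Y : Set P) → (∀ (X' X'' : AlgebraicGeometry.Scheme.{0}) (σ' : X' ⟶ P) (Y' : Set X') (C : X'.IdealSheafData) (τ : X'' ⟶ X'), Q X' σ' Y' → Literature.AlgebraicGeometry.Resolution.IsBlowup τ C → Literature.AlgebraicGeometry.Resolution.Scheme.IsRegular C.subscheme → σ' '' (C.support : Set X') ⊆ {x : P | ¬ IsGenericPoint x (Y : Set P)} → Q X'' (CategoryTheory.CategoryStruct.comp τ σ') (closure (τ ⁻¹' (Y' \ (C.support : Set X'))))) → Q P' σ S') ∧ IsIrreducible (((CategoryTheory.CategoryStruct.comp σ q)) ⁻¹' {IsLocalRing.closedPoint O}) ∧ Set.Finite {x : ↥(AlgebraicGeometry.Scheme.IdealSheafData.vanishingIdeal (⟨closure S', isClosed_closure⟩ : TopologicalSpace.Closeds P')).subscheme | ¬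 IsRegularLocalRing ((AlgebraicGeometry.Scheme.IdealSheafData.vanishingIdeal (⟨closure S', isClosed_closure⟩ : TopologicalSpace.Closeds P')).subscheme.presheaf.stalk x)} ∧ (∀ x : ↥(AlgebraicGeometry.Scheme.IdealSheafData.vanishingIdeal (⟨closure S', isClosed_closure⟩ : TopologicalSpace.Closeds P')).subscheme, ¬ IsRegularLocalRing ((AlgebraicGeometry.Scheme.IdealSheafData.vanishingIdeal (⟨closure S', isClosed_closure⟩ : TopologicalSpace.Closeds P')).subscheme.presheaf.stalk x) → IsRegularLocalRing (P'.presheaf.stalk ((AlgebraicGeometry.Scheme.IdealSheafData.vanishingIdeal (⟨closure S', isClosed_closure⟩ : TopologicalSpace.Closeds P')).subschemeι x)) ∧ ∀ ϖ : O, Irreducible ϖ → (P'.presheaf.Γgerm ((AlgebraicGeometry.Scheme.IdealSheafData.vanishingIdeal (⟨closure S', isClosed_closure⟩ : TopologicalSpace.Closeds P')).subschemeι x)).hom (((CategoryTheory.CategoryStruct.comp σ q)).appTop.hom ((AlgebraicGeometry.Scheme.ΓSpecIso (CommRingCat.of O)).inv.hom ϖ)) ∉ (IsLocalRing.maximalIdeal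 (P'.presheaf.stalk ((AlgebraicGeometry.Scheme.IdealSheafData.vanishingIdeal (⟨closure S', isClosed_closure⟩ : TopologicalSpace.Closeds P')).subschemeι x))) ^ 2)

/-- **Child 2 (crux, rank 3): ISOLATED POINT DROP.** For every complete DVR `O` of characteristic `0` with
algebraically closed residue field, every smooth proper `q : P → Spec O`, every IRREDUCIBLE closed `Y ⊆ P` inside the
special fibre, and every `(P₁, σ₁, S₁)` reached from `(P, 𝟙, Y)` by a chain of blow-ups in regular centres off the
generic point of `Y` with irreducible special fibre of `P₁ → Spec O`: if the reduced closed subscheme on `closure S₁`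
has finitely many and at least one non-regular point, and the ambient `P₁` has good reduction at each of them (regular,
uniformizer a regular parameter), then some `(P₂, σ₂, S₂)` reached from `(P₁, 𝟙, closure S₁)` by a chain of blow-ups in
regular centres off the generic point of `closure S₁`, with irreducible special fibre of `P₂ → P₁ → P → Spec O`, has a
reduced closed subscheme on `closure S₂` with finitely many and STRICTLY FEWER non-regular points, the ambient `P₂` again
having good reduction at each of them. A route-posited OPEN sub-statement (child 2 of the strategist's split of the crux; not a
published result). Informal sources of the programme: Artin 1977 (rational double points lift with their Dynkin type),
Ishii 2025 Cor 1.5, Hauser–Perlega 2019 §3, Kollár 2026, arXiv:1005.4503 Thm 5. -/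
def IsolatedPointDrop : Prop :=
  ∀ (O : Type) [CommRing O] [IsDomain O] [IsDiscreteValuationRing O] [CharZero O] [IsAdicComplete (IsLocalRing.maximalIdeal O) O] [IsAlgClosed (IsLocalRing.ResidueField O)] (P P₁ : AlgebraicGeometry.Scheme.{0}) (q : P ⟶ AlgebraicGeometry.Spec (.of O)) (Y : TopologicalSpace.Closeds P) (σ₁ : P₁ ⟶ P) (S₁ : Set P₁), AlgebraicGeometry.Smooth q → AlgebraicGeometry.IsProper q → (Y : Set P) ⊆ q ⁻¹' {IsLocalRing.closedPoint O} → IsIrreducible (Y : Set P) → (∀ Q : (∀ X' : AlgebraicGeometry.Scheme.{0}, (X' ⟶ P) → Set X' → Prop), Q P (CategoryTheory.CategoryStruct.id P) (Y : Set P) → (∀ (X' X'' : AlgebraicGeometry.Scheme.{0}) (σ' : X' ⟶ P) (Y' : Set X') (C : X'.IdealSheafData) (τ : X'' ⟶ X'), Q X' σ' Y' → Literature.AlgebraicGeometry.Resolution.IsBlowup τ C → Literature.AlgebraicGeometry.Resolution.Scheme.IsRegular C.subscheme → σ' '' (C.support : Set X') ⊆ {x : P | ¬ IsGenericPoint x (Y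 : Set P)} → Q X'' (CategoryTheory.CategoryStruct.comp τ σ') (closure (τ ⁻¹' (Y' \ (C.support : Set X'))))) → Q P₁ σ₁ S₁) → IsIrreducible (((CategoryTheory.CategoryStruct.comp σ₁ q)) ⁻¹' {IsLocalRing.closedPoint O}) → Set.Finite {x : ↥(AlgebraicGeometry.Scheme.IdealSheafData.vanishingIdeal (⟨closure S₁, isClosed_closure⟩ : TopologicalSpace.Closeds P₁)).subscheme | ¬ IsRegularLocalRing ((AlgebraicGeometry.Scheme.IdealSheafData.vanishingIdeal (⟨closure S₁, isClosed_closure⟩ : TopologicalSpace.Closeds P₁)).subscheme.presheaf.stalk x)} → (∀ x : ↥(AlgebraicGeometry.Scheme.IdealSheafData.vanishingIdeal (⟨closure S₁, isClosed_closure⟩ : TopologicalSpace.Closeds P₁)).subscheme, ¬ IsRegularLocalRing ((AlgebraicGeometry.Scheme.IdealSheafData.vanishingIdeal (⟨closure S₁, isClosed_closure⟩ : TopologicalSpace.Closeds P₁)).subscheme.presheaf.stalk x) → IsRegularLocalRing (P₁.presheaf.stalk ((AlgebraicGeometry.Scheme.IdealSheafData.vanishingIdeal (⟨closure S₁, isClosed_closure⟩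 : TopologicalSpace.Closeds P₁)).subschemeι x)) ∧ ∀ ϖ : O, Irreducible ϖ → (P₁.presheaf.Γgerm ((AlgebraicGeometry.Scheme.IdealSheafData.vanishingIdeal (⟨closure S₁, isClosed_closure⟩ : TopologicalSpace.Closeds P₁)).subschemeι x)).hom (((CategoryTheory.CategoryStruct.comp σ₁ q)).appTop.hom ((AlgebraicGeometry.Scheme.ΓSpecIso (CommRingCat.of O)).inv.hom ϖ)) ∉ (IsLocalRing.maximalIdeal (P₁.presheaf.stalk ((AlgebraicGeometry.Scheme.IdealSheafData.vanishingIdeal (⟨closure S₁, isClosed_closure⟩ : TopologicalSpace.Closeds P₁)).subschemeι x))) ^ 2) → Set.Nonempty {x : ↥(AlgebraicGeometry.Scheme.IdealSheafData.vanishingIdeal (⟨closure S₁, isClosed_closure⟩ : TopologicalSpace.Closeds P₁)).subscheme | ¬ IsRegularLocalRing ((AlgebraicGeometry.Scheme.IdealSheafData.vanishingIdeal (⟨closure S₁, isClosed_closure⟩ : TopologicalSpace.Closeds P₁)).subscheme.presheaf.stalk x)} → ∃ (P₂ : AlgebraicGeometry.Scheme.{0}) (σ₂ : P₂ ⟶ P₁)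 (S₂ : Set P₂), (∀ Q : (∀ X' : AlgebraicGeometry.Scheme.{0}, (X' ⟶ P₁) → Set X' → Prop), Q P₁ (CategoryTheory.CategoryStruct.id P₁) (closure S₁) → (∀ (X' X'' : AlgebraicGeometry.Scheme.{0}) (σ' : X' ⟶ P₁) (Y' : Set X') (C : X'.IdealSheafData) (τ : X'' ⟶ X'), Q X' σ' Y' → Literature.AlgebraicGeometry.Resolution.IsBlowup τ C → Literature.AlgebraicGeometry.Resolution.Scheme.IsRegular C.subscheme → σ' '' (C.support : Set X') ⊆ {x : P₁ | ¬ IsGenericPoint x (closure S₁)} → Q X'' (CategoryTheory.CategoryStruct.comp τ σ') (closure (τ ⁻¹' (Y' \ (C.support : Set X'))))) → Q P₂ σ₂ S₂) ∧ IsIrreducible (((CategoryTheory.CategoryStruct.comp (CategoryTheory.CategoryStruct.comp σ₂ σ₁) q)) ⁻¹' {IsLocalRing.closedPoint O}) ∧ Set.Finite {x : ↥(AlgebraicGeometry.Scheme.IdealSheafData.vanishingIdeal (⟨closure S₂, isClosed_closure⟩ : TopologicalSpace.Closeds P₂)).subscheme | ¬ IsRegularLocalRing ((AlgebraicGeometry.Scheme.IdealSheafData.vanishingIdeal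 (⟨closure S₂, isClosed_closure⟩ : TopologicalSpace.Closeds P₂)).subscheme.presheaf.stalk x)} ∧ (∀ x : ↥(AlgebraicGeometry.Scheme.IdealSheafData.vanishingIdeal (⟨closure S₂, isClosed_closure⟩ : TopologicalSpace.Closeds P₂)).subscheme, ¬ IsRegularLocalRing ((AlgebraicGeometry.Scheme.IdealSheafData.vanishingIdeal (⟨closure S₂, isClosed_closure⟩ : TopologicalSpace.Closeds P₂)).subscheme.presheaf.stalk x) → IsRegularLocalRing (P₂.presheaf.stalk ((AlgebraicGeometry.Scheme.IdealSheafData.vanishingIdeal (⟨closure S₂, isClosed_closure⟩ : TopologicalSpace.Closeds P₂)).subschemeι x)) ∧ ∀ ϖ : O, Irreducible ϖ → (P₂.presheaf.Γgerm ((AlgebraicGeometry.Scheme.IdealSheafData.vanishingIdeal (⟨closure S₂, isClosed_closure⟩ : TopologicalSpace.Closeds P₂)).subschemeι x)).hom (((CategoryTheory.CategoryStruct.comp (CategoryTheory.CategoryStruct.comp σ₂ σ₁) q)).appTop.hom ((AlgebraicGeometry.Scheme.ΓSpecIso (CommRingCat.of O)).inv.hom ϖ)) ∉ (IsLocalRing.maximalIdeal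 (P₂.presheaf.stalk ((AlgebraicGeometry.Scheme.IdealSheafData.vanishingIdeal (⟨closure S₂, isClosed_closure⟩ : TopologicalSpace.Closeds P₂)).subschemeι x))) ^ 2) ∧ Set.ncard {x : ↥(AlgebraicGeometry.Scheme.IdealSheafData.vanishingIdeal (⟨closure S₂, isClosed_closure⟩ : TopologicalSpace.Closeds P₂)).subscheme | ¬ IsRegularLocalRing ((AlgebraicGeometry.Scheme.IdealSheafData.vanishingIdeal (⟨closure S₂, isClosed_closure⟩ : TopologicalSpace.Closeds P₂)).subscheme.presheaf.stalk x)} < Set.ncard {x : ↥(AlgebraicGeometry.Scheme.IdealSheafData.vanishingIdeal (⟨closure S₁, isClosed_closure⟩ : TopologicalSpace.Closeds P₁)).subscheme | ¬ IsRegularLocalRing ((AlgebraicGeometry.Scheme.IdealSheafData.vanishingIdeal (⟨closure S₁, isClosed_closure⟩ : TopologicalSpace.Closeds P₁)).subscheme.presheaf.stalk x)}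

/-! ## Helper notions used only in the proofs (each unfolds, by `Iff.rfl`, to the inlined text above) -/

/-- The recursor-encoded chain of blow-ups in regular centres off the generic point(s) of `Y`
(verbatim the fifth conjunct of `EquisingularLift`, abstracted in `P, Y, P', σ, S'`). -/
def Chain (P : Scheme.{0}) (Y : Set P) (P' : Scheme.{0}) (σ : P' ⟶ P) (S' : Set P') : Prop :=
  ∀ Q : (∀ X' : AlgebraicGeometry.Scheme.{0}, (X' ⟶ P) → Set X' → Prop),
    Q P (CategoryTheory.CategoryStruct.id P) Y →
    (∀ (X' X'' : AlgebraicGeometry.Scheme.{0}) (σ' : X' ⟶ P) (Y' : Set X') (C : X'.IdealSheafData)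
      (τ : X'' ⟶ X'), Q X' σ' Y' → Literature.AlgebraicGeometry.Resolution.IsBlowup τ C →
      Literature.AlgebraicGeometry.Resolution.Scheme.IsRegular C.subscheme →
      σ' '' (C.support : Set X') ⊆ {x : P | ¬ IsGenericPoint x Y} →
      Q X'' (CategoryTheory.CategoryStruct.comp τ σ') (closure (τ ⁻¹' (Y' \ (C.support : Set X'))))) →
    Q P' σ S'

/-- The non-regular locus of the reduced closed subscheme on `closure S'`. -/
def singSet {P' : Scheme.{0}} (S' : Set P') : Set ↥((Scheme.IdealSheafData.vanishingIdeal
    (⟨closure S', isClosed_closure⟩ : Closeds P')).subscheme) :=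
  {x | ¬ IsRegularLocalRing (((Scheme.IdealSheafData.vanishingIdeal
    (⟨closure S', isClosed_closure⟩ : Closeds P')).subscheme).presheaf.stalk x)}

/-- GOOD REDUCTION OF THE AMBIENT AT A POINT: the ambient `P'` (with structure morphism `r` to `Spec O`) is
regular at `y` and the uniformizer of `O` is a regular PARAMETER there (`ϖ ∉ 𝔪_y²`) — for the `O`-flat
finite-type stages of a chain this says exactly that `P' → Spec O` is smooth at `y` (regular special fibre at
`y`, residue field of `O` algebraically closed). -/
def GoodAt {O : Type} [CommRing O] {P' : Scheme.{0}} (r : P' ⟶ Spec (.of O)) (y : P') : Prop :=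
  IsRegularLocalRing (P'.presheaf.stalk y) ∧
    ∀ ϖ : O, Irreducible ϖ → (P'.presheaf.Γgerm y).hom (r.appTop.hom ((Scheme.ΓSpecIso (.of O)).inv.hom ϖ)) ∉
      (IsLocalRing.maximalIdeal (P'.presheaf.stalk y)) ^ 2

/-- The good-reduction clause of the split: the ambient has good reduction at every NON-REGULAR point of the
reduced strict transform `V(closure S')`. -/
def GoodSet {O : Type} [CommRing O] {P' : Scheme.{0}} (r : P' ⟶ Spec (.of O)) (S' : Set P') : Prop :=
  ∀ x : ↥((Scheme.IdealSheafData.vanishingIdeal (⟨closure S', isClosed_closure⟩ : Closeds P')).subscheme),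
    ¬ IsRegularLocalRing (((Scheme.IdealSheafData.vanishingIdeal
      (⟨closure S', isClosed_closure⟩ : Closeds P')).subscheme).presheaf.stalk x) →
    GoodAt r ((Scheme.IdealSheafData.vanishingIdeal (⟨closure S', isClosed_closure⟩ : Closeds P')).subschemeι x)

end Split

end Summit.ResolutionOfSingularities.ResolutionOfSingularities.Theses.EquisingularLift
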